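import Literature.MathematicalPhysics.QuantumFieldTheory.Balaban1983to89.BlockAveragingHaarAC
import Literature.MathematicalPhysics.QuantumFieldTheory.Balaban1983to89.BlockAveragingTwoLevel

/-!
# `HaarAC` for Bałaban's TWO-LEVEL block averaging (0.11)–(0.12) on `SU(2)`, for every axiomatic group average `M`

`BlockAveragingTwoLevel` types the second of the two averaging operations of [Balaban1987RG1] — the two-level prescription
(0.12) p. 254 built from the averaged contour variables (0.11) p. 253 — as a total `Setup.Averaging`
`BlockAveragingTwoLevel.blockAvg₂ 𝓜 ℰ` over an axiomatic GROUP average `𝓜 : Setup.GroupAverage G` (inner, (0.5)–(0.7)) and a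
small-loop average `ℰ : BlockAveraging.LoopAverage G` (outer), and records (its §6) that finite-`ε` data `D` WITH
`∀ K j, D.av K j = blockAvg₂ 𝓜 ℰ` satisfy the reflection-positivity and torus-covariance targets of `T4Continuum`.  Whether such
data EXIST is the measure-theoretic residual `T4FiniteEpsInhabited.HaarAC` of the averaging FUNCTION (absolute continuity of the
push-forward of product Haar measure), exactly as for the one-level averaging (0.4) (`T4FiniteEpsInhabited`, "THE RESIDUAL";
discharged for (0.4) with the projected mean in `BlockAveragingHaarAC`).  This module discharges it for (0.12) on `SU(2)`: for
EVERY group average `𝓜` on `SU(2)` with measurable `M` (in particular `su2GroupMean`) and the quaternionic projected mean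
`su2Mean` as the outer average, `HaarAC (avgFun₂ 𝓜 su2Mean)` holds on every torus in the standing range
(`haarAC_avgFun₂_su2Mean_of_le`),
hence `∃ D : FiniteEpsData F SU(2), ∀ K j, D.av K j = blockAvg₂ 𝓜 su2Mean` (`exists_blockAvg₂_su2Mean`).

WHAT IS QUOTED (rendered pages of T. Bałaban, *Renormalization group approach to lattice gauge field theories. I*, Commun. Math.
Phys. **109** (1987) 249–301 [Balaban1987RG1], cell READING rows C-pv11g5-1, C-pv11g5-2 and C-pv03-13; the formulas are
typed in the tree modules `BlockAveraging` ((0.4), the staircase families of p. 252) and `BlockAveragingTwoLevel` ((0.11),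
(0.12)), whose headers quote them in full).  Page 253: "It is a Gᶜ-valued function defined on sets {U_j : j = 1, 2, …, n},
U_j ∈ Gᶜ, with sufficiently small diameters. We denote it by {U_j}‾ = M({U_j}), and we assume that it is an analytic function
having the following properties: M({U_j⁻¹}) = M({U_j})⁻¹; (0.5) M({uU_jv}) = uM({U_j})v; (0.6) M(π{U_j}) = M({U_j}) for an
arbitrary permutation π of the set {U_j}; (0.7)" and "U(y, x) = M({U(Γ)}_{Γ ∈ G(y,x)}). (0.11)".  Page 254: "Ū(c) =
exp[ i Σ_{x ∈ B(c₋)} L^{-d} (1/i) log U(c₋, x)U([x, x′])U(x′, c₊)U(−c) ] U(c). (0.12)".  Nothing else of the series is used; no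
hypothesis names a result of the series.

## The argument (the one of `BlockAveragingHaarAC`, run for (0.12))

Private coordinates `β(c)` = the central crossing bond of the straight line of `c` (`BlockAveragingHaarAC.centralBond`).

* **(A) locality.** No staircase of `G(y, x)` — at `c₋` or at `c₊` — traverses a central crossing bond
  (`BlockAveragingHaarAC.ne_centralBond_of_mem_walk_stairWord`), so the averaged contour variables `U(c′₋, x)`, `U(x′, c′₊)` and
  the admissibility guards of (0.11) never see `U(β(c))` (`stairHol_update_centralBond`); the transported segment `[x, x′]` at
  `c′` and the bond variable `U(c′)` see it only for `c′ = c` (`BlockAveragingHaarAC.eq_of_mem_walk_replicate_of_eq_centralBond`,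
  `axialAvg_update_centralBond_of_ne`).  Hence `T4TriangularPushforward.IsLocal centralBond (avgFun₂ 𝓜 ℰ)` for EVERY group,
  `𝓜` and `ℰ` (`isLocal_avgFun₂`).
* **(B) central loops are trivial, for every `M`.** For `x` ON the line of `c` all staircases of `G(c₋, x)` coincide (a single
  run), so the inner family is CONSTANT; by (0.6) and (0.5) alone, `M(u, …, u) = u · z_M` with `z_M = M(1, …, 1)` a CENTRAL
  INVOLUTION (`GroupAverage.avg_const`, `unitAvg_comm`, `unitAvg_mul_self`) — so the two factors `z_M` cancel and
  `U(c₋, x) U([x,x′]) U(x′, c₊) = U(c)` (`openHol₂_of_isCentralPt`; the runs backtrack,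
  `BlockAveragingHaarAC.holAt_walk_openWord_of_forall_ne`), i.e. the loop variable of (0.12) at a central `x` is `1`.  Off the
  line the open part does not see `U(β(c))` (`openHol₂_update_of_not_isCentralPt`).

On `SU(2)` with the outer average `su2Mean` ((0.6) two-sided, `BlockAveragingSU2.mean_mul_mul`): on the small-field domain
`Small₂`, `Ū(c) = mean(open parts)` (`avgFun₂_eq_mean_openHol₂`) and, in the private coordinate `g = U(β(c))` alone,
`Ū(c) = pre · translateProj a g · post` with a `g`-free quaternion shift (`avgFun₂_update_of_small₂`); off it
`Ū(c) = pre · g · post`.  Both one-variable laws are absolutely continuous (`T4HaarSU2Translate`), so is their measurable splice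
(`T4TriangularPushforward.absolutelyContinuous_map_of_forall_eq_or`), and the triangular push-forward lemma
`T4TriangularPushforward.map_pi_absolutelyContinuous_pi` gives `HaarAC`.

## What this is NOT

`exists_blockAvg₂_su2Mean` inhabits the CARRIER `FiniteEpsData F SU(2)` with data averaging by (0.12); the inhabitant is the stub
of `T4FiniteEpsInhabited` §3 (placeholder `Realisation`), at which the pinned end statement (B) of the cell FAILS
(`not_endStatementBPrinted_blockAvg₂_stub`).  Nothing here is progress on the continuum limit (Theorems 1–2 of [Balaban1987RG1])
or on the summit; every result is elementary lattice combinatorics, group algebra and measure theory ([folklore]) about the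
published formulas (0.5)–(0.7), (0.11), (0.12).  DIVERGENCE: none in any statement — the private coordinates and the constant
`z_M` are proof devices; the totalisation guard `Small₂` is the one of `BlockAveragingTwoLevel` (cell `DIVERGENCE.md` D-pv11g5.1).
-/

noncomputable section

open MeasureTheory Function
open scoped Quaternion

namespace Literature.MathematicalPhysics.QuantumFieldTheory.Balaban1983to89

/-! ## 0. Constant families under an axiomatic group average: `M(u, …, u) = u · z_M`, `z_M` a central involution -/

namespace GroupAverage

variable {G : Type*} [GaugeGroup G] (𝓜 : GroupAverage G)

/-- A constant family has diameter `0 < δ` (it lies in the domain "with sufficiently small diameters" of p. 253). [folklore] -/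
theorem familySmall_const {n : ℕ} (u : G) : FamilySmall 𝓜.δ (fun _ : Fin (n+1) => u) := by
  intro i k
  rw [mul_inv_cancel, GaugeGroup.dist1_one]
  exact 𝓜.δ_pos

/-- `z_M := M(1, …, 1)`, the average of the constant family `1` over the (nonempty finite) index type `ι`. [folklore] -/
def unitAvg (ι : Type*) [Fintype ι] [Nonempty ι] : G := 𝓜.avg (fun _ : ι => (1 : G))

variable {ι : Type*} [Fintype ι] [Nonempty ι]

/-- **`M(u, …, u) = u · z_M`**: the printed (0.6) p. 253 with `v = 1` on the constant family `1`. [folklore] -/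
theorem avg_const (u : G) : 𝓜.avg (fun _ : ι => u) = u * 𝓜.unitAvg ι := by
  have h := 𝓜.equivariant (fun _ : Fin (Fintype.card ι - 1 + 1) => (1 : G)) (𝓜.familySmall_const 1) u 1
  simp only [mul_one] at h
  exact h

/-- `M(W) = u · z_M` for a family constantly equal to `u`. [folklore] -/
theorem avg_congr_const {W : ι → G} {u : G} (h : ∀ i, W i = u) : 𝓜.avg W = u * 𝓜.unitAvg ι := by
  rw [show W = fun _ => u from funext h]
  exact 𝓜.avg_const u

/-- **`z_M` IS CENTRAL**: the printed (0.6) p. 253 with `(u, v) = (x, x⁻¹)` on the constant family `1`. [folklore] -/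
theorem unitAvg_comm (x : G) : 𝓜.unitAvg ι * x = x * 𝓜.unitAvg ι := by
  have h := 𝓜.equivariant (fun _ : Fin (Fintype.card ι - 1 + 1) => (1 : G)) (𝓜.familySmall_const 1) x x⁻¹
  simp only [mul_one, mul_inv_cancel] at h
  rw [eq_mul_inv_iff_mul_eq] at h
  exact h

/-- **`z_M² = 1`**: the printed (0.5) p. 253 on the constant family `1`. [folklore] -/
theorem unitAvg_mul_self : 𝓜.unitAvg ι * 𝓜.unitAvg ι = 1 := by
  have h := 𝓜.inv (fun _ : Fin (Fintype.card ι - 1 + 1) => (1 : G)) (𝓜.familySmall_const 1)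
  simp only [inv_one] at h
  exact mul_eq_one_iff_eq_inv.mpr h

/-- Group algebra: a central involution inserted twice cancels, `R z S (R′⁻¹ z) = R S R′⁻¹`. [folklore] -/
theorem mul_mul_mul_inv_mul_of_comm {H : Type*} [Group H] (R S R' z : H) (hz : ∀ x, z * x = x * z) (hzz : z * z = 1) :
    R * z * S * (R'⁻¹ * z) = R * S * R'⁻¹ := by
  rw [mul_assoc R z S, hz S, ← mul_assoc R S z, mul_assoc (R * S) z (R'⁻¹ * z), ← mul_assoc z R'⁻¹ z, hz R'⁻¹,
    mul_assoc R'⁻¹ z z, hzz, mul_one]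

end GroupAverage

namespace BlockAveragingTwoLevelHaarAC

open T4Continuum AveragingRT BlockAveraging BlockAveragingTwoLevel BlockAveragingHaarAC
open T4ReflectionCone (holAt_congr)

/-! ## 1. Locality of the two-level averaging in the private coordinates `β` (FACT (A) for (0.12)) -/

section Locality

variable {P : Params} {j : ℕ} {G : Type*} [GaugeGroup G] [DecidableEq (PBond P j)] (𝓜 : GroupAverage G) (ℰ : LoopAverage G)

/-- The staircase transporters `U(Γ)`, `Γ ∈ G(y, x)`, `x ∈ B(y)`, at ANY centre `y` do not see `U(β(c))`: no staircase bond is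
a central crossing bond. [folklore] -/
theorem stairHol_update_centralBond (hj : j + 1 ≤ P.m + P.K) (U : GaugeField P j G) (c : PBond P (j+1)) (y : Site P (j+1))
    (r : Pt P) (g : G) : stairHol (update U (centralBond c) g) y (off r) = stairHol U y (off r) := by
  funext σ
  unfold stairHol
  exact holAt_congr fun s hs => update_of_ne (ne_centralBond_of_mem_walk_stairWord hj c y σ (off r) (off_bounds r) hs) _ _

/-- Hence neither does the averaged contour variable `U(y, x)` of (0.11) … [folklore] -/
theorem cVar_update_centralBond (hj : j + 1 ≤ P.m + P.K) (U : GaugeField P j G) (c : PBond P (j+1)) (y : Site P (j+1))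
    (r : Pt P) (g : G) : cVar 𝓜 (update U (centralBond c) g) y (off r) = cVar 𝓜 U y (off r) := by
  unfold cVar
  rw [stairHol_update_centralBond hj]

/-- … nor `U(x, y)`. [folklore] -/
theorem cVarRev_update_centralBond (hj : j + 1 ≤ P.m + P.K) (U : GaugeField P j G) (c : PBond P (j+1)) (y : Site P (j+1))
    (r : Pt P) (g : G) : cVarRev 𝓜 (update U (centralBond c) g) y (off r) = cVarRev 𝓜 U y (off r) := by
  unfold cVarRev
  rw [stairHol_update_centralBond hj]

/-- The transported segments `U([x, x′])` at `c′ ≠ c` do not see `U(β(c))`. [folklore] -/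
theorem seg_update_centralBond_of_ne (hj : j + 1 ≤ P.m + P.K) (U : GaugeField P j G) (c c' : PBond P (j+1)) (hc : c' ≠ c)
    (r : Pt P) (g : G) : seg (update U (centralBond c) g) c' (off r) = seg U c' (off r) := by
  unfold seg
  refine holAt_congr fun s hs => update_of_ne ?_ _ _
  intro hsc
  have h := (eq_of_mem_walk_replicate_of_eq_centralBond hj c c'.src c'.dir (off r) (off_bounds r)
    (x := offSite c'.src (off r)) (fun _ => rfl) hs hsc).1
  exact hc (by rw [h])

/-- The loop variables of (0.12) at `c′ ≠ c` do not see `U(β(c))`. [folklore] -/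
theorem loopHol₂_update_centralBond_of_ne (hj : j + 1 ≤ P.m + P.K) (U : GaugeField P j G) (c c' : PBond P (j+1))
    (hc : c' ≠ c) (g : G) : loopHol₂ 𝓜 (update U (centralBond c) g) c' = loopHol₂ 𝓜 U c' := by
  funext r
  unfold loopHol₂
  rw [cVar_update_centralBond 𝓜 hj, cVarRev_update_centralBond 𝓜 hj, seg_update_centralBond_of_ne hj U c c' hc,
    axialAvg_update_centralBond_of_ne hj U c c' hc]

/-- The small-field guard of (0.12) at `c′ ≠ c` does not see `U(β(c))`. [folklore] -/
theorem small₂_update_centralBond_iff_of_ne (hj : j + 1 ≤ P.m + P.K) (U : GaugeField P j G) (c c' : PBond P (j+1))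
    (hc : c' ≠ c) (g : G) : Small₂ 𝓜 ℰ (update U (centralBond c) g) c' ↔ Small₂ 𝓜 ℰ U c' := by
  unfold Small₂
  simp only [loopHol₂_update_centralBond_of_ne 𝓜 hj U c c' hc, stairHol_update_centralBond hj]

/-- The correction factor of (0.12) at `c′ ≠ c` does not see `U(β(c))`. [folklore] -/
theorem corr₂_update_centralBond_of_ne (hj : j + 1 ≤ P.m + P.K) (U : GaugeField P j G) (c c' : PBond P (j+1))
    (hc : c' ≠ c) (g : G) : corr₂ 𝓜 ℰ (update U (centralBond c) g) c' = corr₂ 𝓜 ℰ U c' := by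
  unfold corr₂
  rw [loopHol₂_update_centralBond_of_ne 𝓜 hj U c c' hc]
  by_cases h : Small₂ 𝓜 ℰ U c'
  · rw [if_pos h, if_pos ((small₂_update_centralBond_iff_of_ne 𝓜 ℰ hj U c c' hc g).mpr h)]
  · rw [if_neg h, if_neg (fun h' => h ((small₂_update_centralBond_iff_of_ne 𝓜 ℰ hj U c c' hc g).mp h'))]

/-- **LOCALITY OF THE TWO-LEVEL AVERAGING (0.12) IN THE PRIVATE COORDINATES `β`** (`T4TriangularPushforward.IsLocal`): the
output `Ū(c′)` does not depend on the input `U(β(c))` for `c ≠ c′` — for every group, every group average `M` and every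
small-loop average `ℰ`. [folklore] -/
theorem isLocal_avgFun₂ (hj : j + 1 ≤ P.m + P.K) :
    T4TriangularPushforward.IsLocal (centralBond : PBond P (j+1) → PBond P j)
      (avgFun₂ 𝓜 ℰ : GaugeField P j G → GaugeField P (j+1) G) := by
  intro U c g c' hc
  show corr₂ 𝓜 ℰ (update U (centralBond c) g) c' * axialAvg (update U (centralBond c) g) c' = corr₂ 𝓜 ℰ U c' * axialAvg U c'
  rw [corr₂_update_centralBond_of_ne 𝓜 ℰ hj U c c' hc g, axialAvg_update_centralBond_of_ne hj U c c' hc g]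

end Locality

/-! ## 2. The loop variables of (0.12) in the private coordinate `U(β(c))` (FACT (B) for (0.12)) -/

section NormalForm

variable {P : Params} {j : ℕ} {G : Type*} [GaugeGroup G] (𝓜 : GroupAverage G)

/-- The CENTRAL points `x ∈ B(c₋)`: those on the straight line of `c` (offset `n_ν = 0` for `ν ≠ μ`). [folklore] -/
def IsCentralPt (c : PBond P (j+1)) (r : Pt P) : Prop := ∀ ν, ν ≠ c.dir → off r ν = 0

/-- Centrality of a point is decidable. [folklore] -/
instance (c : PBond P (j+1)) : DecidablePred (IsCentralPt c) := fun r => by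
  unfold IsCentralPt; infer_instance

/-- **THE OPEN PARTS `U(c₋, x) U([x, x′]) U(x′, c₊)`** of the loop variables of (0.12), `x ∈ B(c₋)` of offset `r`.
[cite: Balaban1987RG1, (0.12) p.254] -/
def openHol₂ (U : GaugeField P j G) (c : PBond P (j+1)) (r : Pt P) : G :=
  cVar 𝓜 U c.src (off r) * seg U c (off r) * cVarRev 𝓜 U c.tgt (off r)

/-- The loop variables of (0.12) are `(open part) · U(c)⁻¹`. [folklore] -/
theorem loopHol₂_eq_openHol₂_mul (U : GaugeField P j G) (c : PBond P (j+1)) (r : Pt P) :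
    loopHol₂ 𝓜 U c r = openHol₂ 𝓜 U c r * (axialAvg U c)⁻¹ := rfl

/-- The open word `Γ ∪ [x,x′] ∪ (−Γ′)` of (0.4) has holonomy `U(Γ) · U([x,x′]) · U(Γ′)⁻¹` (staircases from `c₋` and `c₊`).
[folklore] -/
theorem holAt_walk_openWord_eq (U : GaugeField P j G) (c : PBond P (j+1)) (n : Fin P.d → ℤ) (σ σ' : Equiv.Perm (Fin P.d)) :
    holAt U (walk (emb c.src) (openWord P.L c.dir n σ σ')) = stairHol U c.src n σ * seg U c n * (stairHol U c.tgt n σ')⁻¹ := by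
  unfold openWord stairHol seg PBond.tgt
  rw [walk_append, holAt_append, walk_append, holAt_append, walkEnd_stairWord, walkEnd_offSite_replicate,
    ← walkEnd_stairWord (c.src.shift c.dir) σ' n, holAt_walk_wordRev, mul_assoc]

/-- At a central point all staircases of `G(y, x)` coincide (a single run along `μ`). [folklore] -/
theorem stairHol_eq_of_isCentralPt (U : GaugeField P j G) (c : PBond P (j+1)) (y : Site P (j+1)) (r : Pt P)
    (h : IsCentralPt c r) (σ : Equiv.Perm (Fin P.d)) : stairHol U y (off r) σ = stairHol U y (off r) 1 := by
  unfold stairHol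
  rw [stairWord_eq_axisRun_of_forall_ne σ (off r) c.dir h, stairWord_eq_axisRun_of_forall_ne 1 (off r) c.dir h]

/-- At a central point `U(y, x) = U(Γ) · z_M` (constant inner family). [folklore] -/
theorem cVar_eq_of_isCentralPt (U : GaugeField P j G) (c : PBond P (j+1)) (y : Site P (j+1)) (r : Pt P) (h : IsCentralPt c r) :
    cVar 𝓜 U y (off r) = stairHol U y (off r) 1 * 𝓜.unitAvg (Equiv.Perm (Fin P.d)) := by
  unfold cVar
  exact 𝓜.avg_congr_const (stairHol_eq_of_isCentralPt U c y r h)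

/-- At a central point `U(x, y) = U(Γ)⁻¹ · z_M`. [folklore] -/
theorem cVarRev_eq_of_isCentralPt (U : GaugeField P j G) (c : PBond P (j+1)) (y : Site P (j+1)) (r : Pt P)
    (h : IsCentralPt c r) : cVarRev 𝓜 U y (off r) = (stairHol U y (off r) 1)⁻¹ * 𝓜.unitAvg (Equiv.Perm (Fin P.d)) := by
  unfold cVarRev
  exact 𝓜.avg_congr_const fun σ => by rw [stairHol_eq_of_isCentralPt U c y r h σ]

/-- **FACT (B) FOR (0.12): AT A CENTRAL POINT THE OPEN PART IS `U(c)`** — for EVERY group average `M` (the two factors `z_M`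
cancel: `z_M` is a central involution). [folklore] -/
theorem openHol₂_of_isCentralPt (U : GaugeField P j G) (c : PBond P (j+1)) (r : Pt P) (h : IsCentralPt c r) :
    openHol₂ 𝓜 U c r = axialAvg U c := by
  unfold openHol₂
  rw [cVar_eq_of_isCentralPt 𝓜 U c c.src r h, cVarRev_eq_of_isCentralPt 𝓜 U c c.tgt r h,
    GroupAverage.mul_mul_mul_inv_mul_of_comm _ _ _ (𝓜.unitAvg (Equiv.Perm (Fin P.d))) 𝓜.unitAvg_comm 𝓜.unitAvg_mul_self,
    ← holAt_walk_openWord_eq, holAt_walk_openWord_of_forall_ne U c.src c.dir (off r) 1 1 h, ← axialAvg_eq_holAt_walk]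

/-- The transported segment `U([x, x′])` at `c` sees `U(β(c))` only for central `x`. [folklore] -/
theorem seg_update_centralBond_of_not_isCentralPt [DecidableEq (PBond P j)] (hj : j + 1 ≤ P.m + P.K) (U : GaugeField P j G)
    (c : PBond P (j+1)) (r : Pt P) (h : ¬ IsCentralPt c r) (g : G) :
    seg (update U (centralBond c) g) c (off r) = seg U c (off r) := by
  unfold seg
  refine holAt_congr fun s hs => update_of_ne ?_ _ _
  intro hsc
  exact h (eq_of_mem_walk_replicate_of_eq_centralBond hj c c.src c.dir (off r) (off_bounds r)
    (x := offSite c.src (off r)) (fun _ => rfl) hs hsc).2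

/-- FACT (A) for the open parts: at non-central points the open part does not see `U(β(c))`. [folklore] -/
theorem openHol₂_update_of_not_isCentralPt [DecidableEq (PBond P j)] (hj : j + 1 ≤ P.m + P.K) (U : GaugeField P j G)
    (c : PBond P (j+1)) (r : Pt P) (h : ¬ IsCentralPt c r) (g : G) :
    openHol₂ 𝓜 (update U (centralBond c) g) c r = openHol₂ 𝓜 U c r := by
  unfold openHol₂
  rw [cVar_update_centralBond 𝓜 hj, cVarRev_update_centralBond 𝓜 hj, seg_update_centralBond_of_not_isCentralPt hj U c r h g]

/-- Off the small-field domain the two-level averaging is the axial one. [folklore] -/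
theorem avgFun₂_of_not_small₂ (ℰ : LoopAverage G) (U : GaugeField P j G) (c : PBond P (j+1)) (hS : ¬ Small₂ 𝓜 ℰ U c) :
    avgFun₂ 𝓜 ℰ U c = axialAvg U c := by
  show corr₂ 𝓜 ℰ U c * axialAvg U c = axialAvg U c
  unfold corr₂
  rw [if_neg hS, one_mul]

end NormalForm

/-! ## 3. `SU(2)`: the one-variable law of `Ū(c)` in `U(β(c))` and `HaarAC`, for every group average `M` -/

section SU2

open SU2Mean T4HaarSU2Translate T4TriangularPushforward
open Literature.MathematicalPhysics.QuantumLattice (quatMatrix det_quatMatrix su2Quat su2Quat_ne_zero quatToSU2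
  quatToSU2_smul)

variable {P : Params} {j : ℕ} (𝓜 : GroupAverage (Matrix.specialUnitaryGroup (Fin 2) ℂ))

/-- The loop family of (0.12) is the two-sided translate `1 · V · U(c)⁻¹` of the open family. [folklore] -/
theorem loopHol₂_eq (U : GaugeField P j (Matrix.specialUnitaryGroup (Fin 2) ℂ)) (c : PBond P (j+1)) :
    loopHol₂ 𝓜 U c = fun r => (1 : Matrix.specialUnitaryGroup (Fin 2) ℂ) * openHol₂ 𝓜 U c r * (axialAvg U c)⁻¹ :=
  funext fun r => by rw [one_mul]; rfl

/-- On the small-field domain the Euclidean sum of the open family is non-degenerate. [folklore] -/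
theorem det_qsum_openHol₂_ne_zero (U : GaugeField P j (Matrix.specialUnitaryGroup (Fin 2) ℂ)) (c : PBond P (j+1))
    (hS : Small₂ 𝓜 su2Mean U c) : (qsum (openHol₂ 𝓜 U c)).det ≠ 0 := by
  have h1 : (qsum (loopHol₂ 𝓜 U c)).det ≠ 0 :=
    det_qsum_ne_zero_of_dist1_lt_one _ (fun r => by simpa using hS.2.2 r)
  rw [loopHol₂_eq, qsum_mul_mul, Matrix.det_mul, Matrix.det_mul, det_coe_eq_one, det_coe_eq_one, one_mul,
    mul_one] at h1
  exact h1

/-- **`Ū(c) = mean(V)` ON THE SMALL-FIELD DOMAIN**: the factor `U(c)⁻¹` of the loop variables cancels against the coarse bond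
variable `U(c)` of (0.12) ((0.6) two-sided for the outer projected mean, `BlockAveragingSU2.mean_mul_mul`). [folklore] -/
theorem avgFun₂_eq_mean_openHol₂ (U : GaugeField P j (Matrix.specialUnitaryGroup (Fin 2) ℂ)) (c : PBond P (j+1))
    (hS : Small₂ 𝓜 su2Mean U c) : avgFun₂ 𝓜 su2Mean U c = mean (openHol₂ 𝓜 U c) := by
  show corr₂ 𝓜 su2Mean U c * axialAvg U c = mean (openHol₂ 𝓜 U c)
  unfold corr₂
  rw [if_pos hS]
  show su2Mean.E (loopHol₂ 𝓜 U c ∘ (LoopAverage.enum (Pt P)).symm) * axialAvg U c = mean (openHol₂ 𝓜 U c)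
  rw [su2Mean_E, mean_comp_equiv, loopHol₂_eq, mean_mul_mul _ _ _ (det_qsum_openHol₂_ne_zero 𝓜 U c hS), one_mul,
    inv_mul_cancel_right]

/-- The number `N ≥ 1` of central points of `B(c₋)` (`N = L`). [folklore] -/
def nCentral₂ (c : PBond P (j+1)) : ℕ := (Finset.univ.filter (IsCentralPt c)).card

/-- `N ≥ 1` (the centre `x = c₋` is central). [folklore] -/
theorem nCentral₂_pos (c : PBond P (j+1)) : 0 < nCentral₂ c :=
  Finset.card_pos.mpr ⟨fun _ => ⟨(P.L - 1) / 2, half_lt P⟩, by simp [IsCentralPt, off]⟩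

/-- The quaternion sum of the open parts over the NON-central points (independent of `U(β(c))`). [folklore] -/
def offSum₂ (U : GaugeField P j (Matrix.specialUnitaryGroup (Fin 2) ℂ)) (c : PBond P (j+1)) : ℍ :=
  ∑ r ∈ Finset.univ.filter (fun r => ¬ IsCentralPt c r), su2Quat (openHol₂ 𝓜 U c r)

/-- The quaternion barycentre of the open family of `U′ = U[β(c) ↦ g]`: `N · (p̂ ĝ q̂) + B` with `p̂, q̂, B` free of `g`.
[folklore] -/
theorem sum_su2Quat_openHol₂_update [DecidableEq (PBond P j)] (hj : j + 1 ≤ P.m + P.K)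
    (U : GaugeField P j (Matrix.specialUnitaryGroup (Fin 2) ℂ)) (c : PBond P (j+1)) (g : Matrix.specialUnitaryGroup (Fin 2) ℂ) :
    ∑ r, su2Quat (openHol₂ 𝓜 (update U (centralBond c) g) c r) =
      (nCentral₂ c : ℝ) • su2Quat (pre U c * g * post U c) + offSum₂ 𝓜 U c := by
  have h1 : ∑ r ∈ Finset.univ.filter (IsCentralPt c), su2Quat (openHol₂ 𝓜 (update U (centralBond c) g) c r) =
      (nCentral₂ c : ℝ) • su2Quat (pre U c * g * post U c) := by
    rw [Finset.sum_congr rfl (fun r hr => by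
        rw [openHol₂_of_isCentralPt 𝓜 _ c r (Finset.mem_filter.1 hr).2, axialAvg_update_centralBond hj]),
      Finset.sum_const, ← Nat.cast_smul_eq_nsmul ℝ, nCentral₂]
  have h2 : ∑ r ∈ Finset.univ.filter (fun r => ¬ IsCentralPt c r), su2Quat (openHol₂ 𝓜 (update U (centralBond c) g) c r) =
      offSum₂ 𝓜 U c :=
    Finset.sum_congr rfl fun r hr => by
      rw [openHol₂_update_of_not_isCentralPt 𝓜 hj U c r (Finset.mem_filter.1 hr).2 g]
  rw [← Finset.sum_filter_add_sum_filter_not Finset.univ (IsCentralPt c), h1, h2]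

/-- The `g`-free quaternion shift `a = N⁻¹ · p̂⁻¹ B q̂⁻¹` of the one-variable normal form. [folklore] -/
def aShift₂ (U : GaugeField P j (Matrix.specialUnitaryGroup (Fin 2) ℂ)) (c : PBond P (j+1)) : ℍ :=
  ((nCentral₂ c : ℝ))⁻¹ • ((su2Quat (pre U c))⁻¹ * offSum₂ 𝓜 U c * (su2Quat (post U c))⁻¹)

/-- **THE ONE-VARIABLE NORMAL FORM ON THE SMALL-FIELD DOMAIN**: as a function of its private coordinate `g = U(β(c))`, all
other bond variables fixed, `Ū(c) = pre · translateProj a g · post`. [folklore] -/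
theorem avgFun₂_update_of_small₂ [DecidableEq (PBond P j)] (hj : j + 1 ≤ P.m + P.K)
    (U : GaugeField P j (Matrix.specialUnitaryGroup (Fin 2) ℂ)) (c : PBond P (j+1)) (g : Matrix.specialUnitaryGroup (Fin 2) ℂ)
    (hS : Small₂ 𝓜 su2Mean (update U (centralBond c) g) c) :
    avgFun₂ 𝓜 su2Mean (update U (centralBond c) g) c = pre U c * translateProj (aShift₂ 𝓜 U c) g * post U c := by
  have hdet := det_qsum_openHol₂_ne_zero 𝓜 _ c hS
  rw [avgFun₂_eq_mean_openHol₂ 𝓜 _ c hS]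
  apply Subtype.ext
  rw [coe_mean, qsum_eq_quatMatrix, sum_su2Quat_openHol₂_update 𝓜 hj, su2Quat_mul, su2Quat_mul]
  rw [qsum_eq_quatMatrix, sum_su2Quat_openHol₂_update 𝓜 hj, su2Quat_mul, su2Quat_mul, det_quatMatrix] at hdet
  have hp0 : su2Quat (pre U c) ≠ 0 := su2Quat_ne_zero _
  have hq0 : su2Quat (post U c) ≠ 0 := su2Quat_ne_zero _
  have hN : (0 : ℝ) < nCentral₂ c := by exact_mod_cast nCentral₂_pos c
  have hfac : (nCentral₂ c : ℝ) • (su2Quat (pre U c) * su2Quat g * su2Quat (post U c)) + offSum₂ 𝓜 U c =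
      su2Quat (pre U c) * ((nCentral₂ c : ℝ) • su2Quat g +
        (su2Quat (pre U c))⁻¹ * offSum₂ 𝓜 U c * (su2Quat (post U c))⁻¹) * su2Quat (post U c) := by
    rw [mul_add, add_mul, mul_smul_comm, smul_mul_assoc]
    congr 1
    rw [← mul_assoc, ← mul_assoc, mul_inv_cancel₀ hp0, one_mul, mul_assoc, inv_mul_cancel₀ hq0, mul_one]
  have hX0 : (nCentral₂ c : ℝ) • su2Quat g + (su2Quat (pre U c))⁻¹ * offSum₂ 𝓜 U c * (su2Quat (post U c))⁻¹ ≠ 0 := by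
    intro h0
    apply hdet
    rw [hfac, h0, mul_zero, zero_mul, map_zero, Complex.ofReal_zero]
  rw [hfac, projMat_quatMatrix, ← mul_quatToSU2_mul _ _ hX0, translateProj_apply, aShift₂,
    ← quatToSU2_smul hN (su2Quat g + _), smul_add, smul_inv_smul₀ hN.ne']

/-- **THE ONE-VARIABLE LAWS OF (0.12) ARE ABSOLUTELY CONTINUOUS**: for every configuration `U` off `β(c)` the law of `Ū(c)`
under Haar measure in the private coordinate `U(β(c))` is absolutely continuous (measurable `M`). [folklore] -/
theorem map_haar_avgFun₂_update_absolutelyContinuous [DecidableEq (PBond P j)] (hj : j + 1 ≤ P.m + P.K)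
    (hM : ∀ n, Measurable (fun W : Fin (n+1) → Matrix.specialUnitaryGroup (Fin 2) ℂ => 𝓜.M W))
    (U : GaugeField P j (Matrix.specialUnitaryGroup (Fin 2) ℂ)) (c : PBond P (j+1)) :
    (HaarData.haar : Measure (Matrix.specialUnitaryGroup (Fin 2) ℂ)).map
        (fun g => avgFun₂ 𝓜 su2Mean (update U (centralBond c) g) c) ≪ HaarData.haar := by
  refine absolutelyContinuous_map_of_forall_eq_or (f₁ := fun g => pre U c * translateProj (aShift₂ 𝓜 U c) g * post U c)
    (f₂ := fun g => pre U c * translateProj 0 g * post U c) ?_ (measurable_mul_translateProj_mul _ _ _)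
    (measurable_mul_translateProj_mul _ _ _) (fun g => ?_)
    (haarData_map_mul_translateProj_mul_absolutelyContinuous _ _ _)
    (haarData_map_mul_translateProj_mul_absolutelyContinuous _ _ _)
  · exact (measurable_pi_apply c).comp
      ((measurable_avgFun₂ 𝓜 su2Mean hM measurable_su2Mean_E).comp (measurable_update U))
  · by_cases hS : Small₂ 𝓜 su2Mean (update U (centralBond c) g) c
    · exact Or.inl (avgFun₂_update_of_small₂ 𝓜 hj U c g hS)
    · right
      show avgFun₂ 𝓜 su2Mean (update U (centralBond c) g) c = pre U c * translateProj 0 g * post U c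
      rw [avgFun₂_of_not_small₂ 𝓜 _ _ _ hS, axialAvg_update_centralBond hj, translateProj_zero]

/-- **`HaarAC` FOR BAŁABAN'S TWO-LEVEL AVERAGING (0.12) ON `SU(2)`**, on every torus in the standing range `j + 1 ≤ m + K`, for
EVERY axiomatic group average `M` with measurable `M` as the inner average (0.11) and the quaternionic projected mean as the
outer small-loop average — by the triangular push-forward lemma in the private coordinates `β`. [folklore] -/
theorem haarAC_avgFun₂_su2Mean_of_le (hj : j + 1 ≤ P.m + P.K)
    (hM : ∀ n, Measurable (fun W : Fin (n+1) → Matrix.specialUnitaryGroup (Fin 2) ℂ => 𝓜.M W)) :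
    T4FiniteEpsInhabited.HaarAC (avgFun₂ 𝓜 su2Mean :
      GaugeField P j (Matrix.specialUnitaryGroup (Fin 2) ℂ) → GaugeField P (j+1) (Matrix.specialUnitaryGroup (Fin 2) ℂ)) := by
  classical
  unfold T4FiniteEpsInhabited.HaarAC fieldMeasure
  exact map_pi_absolutelyContinuous_pi (HaarData.haar : Measure (Matrix.specialUnitaryGroup (Fin 2) ℂ))
    (isLocal_avgFun₂ 𝓜 su2Mean hj) (centralBond_injective hj) (measurable_avgFun₂ 𝓜 su2Mean hM measurable_su2Mean_E)
    (fun U c => map_haar_avgFun₂_update_absolutelyContinuous 𝓜 hj hM U c)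

/-- **`HaarAC` FOR (0.12) ON EVERY TORUS OF A FAMILY** in the standing range `k < K`. [folklore] -/
theorem haarAC_avgFun₂_su2Mean
    (hM : ∀ n, Measurable (fun W : Fin (n+1) → Matrix.specialUnitaryGroup (Fin 2) ℂ => 𝓜.M W))
    (F : T4Family) (K k : ℕ) (hk : k < K) :
    T4FiniteEpsInhabited.HaarAC (avgFun₂ 𝓜 su2Mean :
      GaugeField (F.P K) k (Matrix.specialUnitaryGroup (Fin 2) ℂ) →
        GaugeField (F.P K) (k + 1) (Matrix.specialUnitaryGroup (Fin 2) ℂ)) :=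
  haarAC_avgFun₂_su2Mean_of_le 𝓜 (by show k + 1 ≤ F.m + K; omega) hM

/-- **FINITE-`ε` DATA ON `SU(2)` AVERAGING BY THE TWO-LEVEL PRESCRIPTION (0.12) EXIST**, for every group average `M` with
measurable `M`: `∃ D : FiniteEpsData F SU(2), ∀ K j, D.av K j = blockAvg₂ M su2Mean` — the hypothesis `h` of
`BlockAveragingTwoLevel` §6 holds of an EXISTING `D`.  The inhabitant is the STUB of `T4FiniteEpsInhabited` §3 (placeholder
`Realisation`): carrier inhabitation, not the theorem (`not_endStatementBPrinted_blockAvg₂_stub`).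
[cite: Balaban1987RG1, (0.12) p.254] -/
theorem exists_blockAvg₂_su2Mean
    (hM : ∀ n, Measurable (fun W : Fin (n+1) → Matrix.specialUnitaryGroup (Fin 2) ℂ => 𝓜.M W)) (F : T4Family) :
    ∃ D : T4Continuum.FiniteEpsData F (Matrix.specialUnitaryGroup (Fin 2) ℂ), ∀ K j, D.av K j = blockAvg₂ 𝓜 su2Mean :=
  ⟨T4FiniteEpsInhabited.stubData F _ (fun _ _ => blockAvg₂ 𝓜 su2Mean)
      (fun _ _ => measurable_avgFun₂ 𝓜 su2Mean hM measurable_su2Mean_E)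
      (fun K k hk => haarAC_avgFun₂_su2Mean 𝓜 hM F K k hk),
    fun _ _ => rfl⟩

/-- HONEST SCOPE: at the inhabitant just produced the pinned end statement (B) FAILS (`T4FiniteEpsInhabited`). [folklore] -/
theorem not_endStatementBPrinted_blockAvg₂_stub
    (hM : ∀ n, Measurable (fun W : Fin (n+1) → Matrix.specialUnitaryGroup (Fin 2) ℂ => 𝓜.M W)) (F : T4Family) :
    ¬ B16.EndStatementBPrinted
      (T4FiniteEpsInhabited.stubData F (Matrix.specialUnitaryGroup (Fin 2) ℂ) (fun _ _ => blockAvg₂ 𝓜 su2Mean)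
        (fun _ _ => measurable_avgFun₂ 𝓜 su2Mean hM measurable_su2Mean_E)
        (fun K k hk => haarAC_avgFun₂_su2Mean 𝓜 hM F K k hk)).C :=
  T4FiniteEpsInhabited.not_endStatementBPrinted_of_stubData F _ _ _ _

/-- Hence finite-`ε` data on `SU(2)` averaging by (0.12) (any measurable inner `M`, outer projected mean) EXIST and satisfy the
reflection-positivity and torus-covariance targets in both forms (the discharge theorems of `BlockAveragingTwoLevel` §6, which
carry the citations). [folklore] -/
theorem exists_blockAvg₂_su2Mean_rp_and_cov
    (hM : ∀ n, Measurable (fun W : Fin (n+1) → Matrix.specialUnitaryGroup (Fin 2) ℂ => 𝓜.M W)) (F : T4Family) :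
    ∃ D : T4Continuum.FiniteEpsData F (Matrix.specialUnitaryGroup (Fin 2) ℂ), (∀ K j, D.av K j = blockAvg₂ 𝓜 su2Mean) ∧
      (D.limit_reflectionPositive' ∧ D.limit_reflectionPositive) ∧ (D.limit_torusCovariant' ∧ D.limit_torusCovariant) := by
  obtain ⟨D, hD⟩ := exists_blockAvg₂_su2Mean 𝓜 hM F
  exact ⟨D, hD, D.avg_limit_reflectionPositive_SU (D.avgMeasurable_of_blockAvg₂ 𝓜 su2Mean hM measurable_su2Mean_E hD),
    D.limit_torusCovariant_of_blockAvg₂ _ _ hD⟩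

/-- **`HaarAC` for the concrete two-level averaging `blockAvg₂ su2GroupMean su2Mean`** (projected means inside and out).
[folklore] -/
theorem haarAC_avgFun₂_su2GroupMean (F : T4Family) (K k : ℕ) (hk : k < K) :
    T4FiniteEpsInhabited.HaarAC (avgFun₂ su2GroupMean su2Mean :
      GaugeField (F.P K) k (Matrix.specialUnitaryGroup (Fin 2) ℂ) →
        GaugeField (F.P K) (k + 1) (Matrix.specialUnitaryGroup (Fin 2) ℂ)) :=
  haarAC_avgFun₂_su2Mean su2GroupMean measurable_su2GroupMean_M F K k hk

/-- **ROW T4-D.G FOR THE TWO-LEVEL PRESCRIPTION**: `∃ D : FiniteEpsData F SU(2), ∀ K j, D.av K j = blockAvg₂ su2GroupMean su2Mean`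
— the hypothesis `h` of `BlockAveragingTwoLevel.limit_rp_and_cov_of_blockAvg₂SU2` / `four_targets_of_exists_blockAvg₂SU2` holds
of an existing `D` (stub inhabitant; (B) fails there). [cite: Balaban1987RG1, (0.12) p.254] -/
theorem exists_blockAvg₂SU2 (F : T4Family) :
    ∃ D : T4Continuum.FiniteEpsData F (Matrix.specialUnitaryGroup (Fin 2) ℂ), ∀ K j, D.av K j = blockAvg₂ su2GroupMean su2Mean :=
  exists_blockAvg₂_su2Mean su2GroupMean measurable_su2GroupMean_M F

/-- And such data satisfy the reflection-positivity and torus-covariance targets in both forms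
(`BlockAveragingTwoLevel.limit_rp_and_cov_of_blockAvg₂SU2`, which carries the citation). [folklore] -/
theorem exists_blockAvg₂SU2_rp_and_cov (F : T4Family) :
    ∃ D : T4Continuum.FiniteEpsData F (Matrix.specialUnitaryGroup (Fin 2) ℂ), (∀ K j, D.av K j = blockAvg₂ su2GroupMean su2Mean) ∧
      (D.limit_reflectionPositive' ∧ D.limit_reflectionPositive) ∧ (D.limit_torusCovariant' ∧ D.limit_torusCovariant) := by
  obtain ⟨D, hD⟩ := exists_blockAvg₂SU2 F
  exact ⟨D, hD, D.limit_rp_and_cov_of_blockAvg₂SU2 hD⟩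

end SU2

end BlockAveragingTwoLevelHaarAC

end Literature.MathematicalPhysics.QuantumFieldTheory.Balaban1983to89

end
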